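import Mathlib.Analysis.SpecialFunctions.Pow.Real
import Summits.MatrixMultiplication.MatrixMultiplication.Theses.ConeDesigns

/-!
# `ConeDesigns.ConesBoundOmega` (stmt-MatrixMultiplication-9764) — proved

Route `MatrixMultiplication/ConeDesigns`, support item `ConesBoundOmega` (pure real-analysis glue of
the route's deciding theorem): if for some `θ > 0` there are arbitrarily large naturals `q` together
with naturals `n, N` satisfying `N·(q−1)^w ≤ q^n` and `q^(n−2−θ) ≤ N`, then `w ≤ 2 + θ`.

Proof: write `s = 2 + θ > 0` and suppose `w > s`. Chaining the two inequalities at a `q ≥ 2`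
gives `q^(n−s)·(q−1)^w ≤ q^n`, i.e. `(q−1)^w ≤ q^s`. But `(q−1)^w = (q−1)^s·(q−1)^(w−s)` and
`q^s ≤ (2(q−1))^s = 2^s·(q−1)^s` (as `q ≤ 2(q−1)`), so `(q−1)^(w−s) ≤ 2^s`, which fails as soon as
`q − 1 > 2^(s/(w−s))`; choosing `q₀` beyond that point contradicts the hypothesis. No limits are
needed — an explicit threshold suffices. All powers are real powers (`Real.rpow`), exactly as in the
route declaration.
-/

-- Summit = sub-problem name here (single-conjunct summit), so the conventional namespace
-- `Summit.MatrixMultiplication.MatrixMultiplication.Theorems` trips `dupNamespace` on every decl.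
set_option linter.dupNamespace false

namespace Summit.MatrixMultiplication.MatrixMultiplication.Theorems

/-- **`ConesBoundOmega` holds** (route ConeDesigns, stmt-MatrixMultiplication-9764): for reals
`w, θ` with `θ > 0`, if for every `q₀` there are naturals `q ≥ q₀`, `n`, `N` with
`N·(q−1)^w ≤ q^n` and `q^(n−2−θ) ≤ N`, then `w ≤ 2 + θ`. Elementary: otherwise
`(q−1)^w ≤ q^(2+θ) ≤ 2^(2+θ)·(q−1)^(2+θ)` forces `(q−1)^(w−2−θ) ≤ 2^(2+θ)`, false for
`q − 1 > 2^((2+θ)/(w−2−θ))`. [folklore] -/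
theorem conesBoundOmega_proof :
    Summit.MatrixMultiplication.MatrixMultiplication.Theses.ConeDesigns.ConesBoundOmega := by
  unfold Summit.MatrixMultiplication.MatrixMultiplication.Theses.ConeDesigns.ConesBoundOmega
  intro w θ hθ h
  by_contra hw
  rw [not_le] at hw
  -- `s = 2 + θ`, `w > s > 0`
  set s : ℝ := 2 + θ with hs_def
  have hs0 : 0 < s := by rw [hs_def]; linarith
  have hws : 0 < w - s := by linarith
  -- threshold: any `q` with `q - 1 > 2 ^ (s / (w - s))` and `q ≥ 2`
  obtain ⟨M, hM⟩ := exists_nat_gt ((2 : ℝ) ^ (s / (w - s)) + 2)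
  obtain ⟨q, n, N, hq, h1, h2⟩ := h M
  have hT0 : (0 : ℝ) ≤ (2 : ℝ) ^ (s / (w - s)) := Real.rpow_nonneg (by norm_num) _
  have hqM : (M : ℝ) ≤ (q : ℝ) := by exact_mod_cast hq
  have hq2 : (2 : ℝ) ≤ (q : ℝ) := by linarith
  have hqpos : (0 : ℝ) < (q : ℝ) := by linarith
  have hq1pos : (0 : ℝ) < (q : ℝ) - 1 := by linarith
  have hq1T : (2 : ℝ) ^ (s / (w - s)) < (q : ℝ) - 1 := by linarith
  -- Step 1: `(q-1)^w ≤ q^s` from the two hypotheses.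
  have key : ((q : ℝ) - 1) ^ w ≤ (q : ℝ) ^ s := by
    have hchain : (q : ℝ) ^ ((n : ℝ) - 2 - θ) * ((q : ℝ) - 1) ^ w ≤ (q : ℝ) ^ (n : ℝ) :=
      le_trans (mul_le_mul_of_nonneg_right h2 (Real.rpow_nonneg hq1pos.le w)) h1
    have hexp : ((n : ℝ) - 2 - θ) = (n : ℝ) - s := by rw [hs_def]; ring
    rw [hexp, Real.rpow_sub hqpos, div_mul_eq_mul_div,
      div_le_iff₀ (Real.rpow_pos_of_pos hqpos s)] at hchain
    exact le_of_mul_le_mul_left hchain (Real.rpow_pos_of_pos hqpos _)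
  -- Step 2: `q^s ≤ 2^s * (q-1)^s` since `q ≤ 2 (q - 1)`.
  have hqs : (q : ℝ) ^ s ≤ (2 : ℝ) ^ s * ((q : ℝ) - 1) ^ s := by
    rw [← Real.mul_rpow (by norm_num) hq1pos.le]
    exact Real.rpow_le_rpow hqpos.le (by linarith) hs0.le
  -- Step 3: `(q-1)^w = (q-1)^s * (q-1)^(w-s)` and `(q-1)^(w-s) > 2^s`.
  have hsplit : ((q : ℝ) - 1) ^ w = ((q : ℝ) - 1) ^ s * ((q : ℝ) - 1) ^ (w - s) := by
    rw [← Real.rpow_add hq1pos]; congr 1; ring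
  have hbig : (2 : ℝ) ^ s < ((q : ℝ) - 1) ^ (w - s) := by
    have h2s : (2 : ℝ) ^ s = ((2 : ℝ) ^ (s / (w - s))) ^ (w - s) := by
      rw [← Real.rpow_mul (by norm_num)]; congr 1; field_simp
    rw [h2s]
    exact Real.rpow_lt_rpow hT0 hq1T hws
  -- Combine: `(q-1)^s * (q-1)^(w-s) ≤ 2^s * (q-1)^s < (q-1)^(w-s) * (q-1)^s`.
  have hq1s : (0 : ℝ) < ((q : ℝ) - 1) ^ s := Real.rpow_pos_of_pos hq1pos s
  have : ((q : ℝ) - 1) ^ s * ((q : ℝ) - 1) ^ (w - s) ≤ ((q : ℝ) - 1) ^ s * (2 : ℝ) ^ s := by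
    calc ((q : ℝ) - 1) ^ s * ((q : ℝ) - 1) ^ (w - s) = ((q : ℝ) - 1) ^ w := hsplit.symm
      _ ≤ (q : ℝ) ^ s := key
      _ ≤ (2 : ℝ) ^ s * ((q : ℝ) - 1) ^ s := hqs
      _ = ((q : ℝ) - 1) ^ s * (2 : ℝ) ^ s := mul_comm _ _
  have hle : ((q : ℝ) - 1) ^ (w - s) ≤ (2 : ℝ) ^ s := le_of_mul_le_mul_left this hq1s
  exact absurd hbig (not_lt.mpr hle)

end Summit.MatrixMultiplication.MatrixMultiplication.Theorems
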